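import Summits.ResolutionOfSingularities.ResolutionOfSingularities.Theorems.PurelyInseparableDim4BinomialClassLocalWin
import Mathlib.FieldTheory.IsAlgClosed.Basic
import HarnessLib

/-!
# [OURS · res-dim4-pi · F4-C-loc] THE BINOMIAL CLASS THEOREM WITH AN ARBITRARY UNIT COEFFICIENT: `⟨x^a + t·x^b, 0, ∅⟩` wins
  OUR local in-scope game for every `t ≠ 0` reached by the torus — in particular for EVERY `t ≠ 0` over an algebraically
  closed field of characteristic 3

Cell `res-dim4-pi` (D-0157 DOOR 2, wave 2), seat `res-dim4-p-6` g5 (offer (a) of the seat's 13:34Z ask).  The class theorem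
`BinomialClass.binomial_localWin_allFields` (p722128) has the coefficient `c ∈ 𝔽₃ˣ`; the torus invariance of the local game
(`Torus.rWins_C_mul_scale_iff`, p-6 g4) moves the `c = 1` member `x^a + x^b` to `x^a + t·x^b` whenever `t` is reached by a
one-coordinate scaling: **`binomial_localWin_of_scaling`** (`s ≠ 0`, `s^{b_j} = s^{a_j}·t` for one coordinate `j`; any field
of characteristic 3), hence **`binomial_localWin_of_isAlgClosed`** (every `t ≠ 0` over an algebraically closed field, using a
coordinate `j` with `a_j ≠ b_j` and a `|b_j − a_j|`-th root of `t^{±1}`).  States are written directly as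
`⟨monomial (expo a) 1 + monomial (expo b) t, 0, ∅⟩`.

HONEST SCOPE: still a theorem about OUR local in-scope game (`LoopCLocal.RWins 3 localB`) on ONE explicit finite class of
exponent pairs (`a ≠ b` in `{0,…,3}⁴`, total degrees `≥ 3`, neither a cube monomial), now with any torus-reachable unit
coefficient; F4-C-loc(3,3) as an ∃-rule statement for ALL states stays OPEN.  [OURS · counted 0 · AI kernel work, weaker than
expert review.]  NOTHING here is a statement about resolution of singularities; resolution in dimension `≥ 4` /
characteristic `p > 0` is NOT proved by anything in this file.  bears_on: LADDER-RESOLUTION:D157-DOOR2 (res-dim4-pi · (3,3)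
LOCAL binomial class · unit coefficients).  Host item (DR-157-C): `stmt-ResolutionOfSingularities-16155`, helper.
-/

set_option linter.dupNamespace false -- mandated namespace of this single-conjunct summit

noncomputable section

open MvPolynomial Finset

namespace Summit.ResolutionOfSingularities.ResolutionOfSingularities.Theorems.PIDim4

namespace LoopCLocal

open Literature.AlgebraicGeometry.Resolution
open Literature.AlgebraicGeometry.Resolution.CentreBlowup
open StepKit

namespace BinomialClass

variable (L : Type) [Field L] [CharP L 3] [DecidableEq L]

omit [DecidableEq L] in
/-- the `c = 1` member of the class, written as a polynomial state. [OURS] -/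
theorem liftState_one_one (a b : Fin 4 → ℕ) :
    liftState L ((⟨[(a, 1), (b, 1)], 0, ∅⟩ : SData 4 (ZMod 3)).toState) =
      (⟨monomial (expo a) 1 + monomial (expo b) 1, 0, ∅⟩ : State L) := by
  show (⟨MvPolynomial.map (φ3 L) (evalT [(a, 1), (b, 1)]), expo (0 : Fin 4 → ℕ), ∅⟩ : State L) = _
  rw [evalT_cons, evalT_cons, evalT_nil, add_zero, map_add, map_monomial, map_monomial, map_one,
    (expo_eq_zero_iff _).mpr rfl]

/-- **unit coefficients reached by a one-coordinate scaling**: if `s ≠ 0` and `s^{b_j} = s^{a_j}·t` for some coordinate `j`,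
then `⟨x^a + t·x^b, 0, ∅⟩` is an A-win of OUR local in-scope game (any field of characteristic 3; class hypotheses as in
`binomial_localWin_allFields`). [OURS] -/
theorem binomial_localWin_of_scaling (a b : Fin 4 → ℕ) (ha : ∀ i, a i ≤ 3) (hb : ∀ i, b i ≤ 3) (ha3 : 3 ≤ ∑ i, a i)
    (hb3 : 3 ≤ ∑ i, b i) (hac : ¬ ∀ i, 3 ∣ a i) (hbc : ¬ ∀ i, 3 ∣ b i) (hab : a ≠ b) {s t : L} (hs : s ≠ 0)
    (j : Fin 4) (hst : s ^ b j = s ^ a j * t) :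
    RWins 3 localB (⟨monomial (expo a) 1 + monomial (expo b) t, 0, ∅⟩ : State L) := by
  have h1 := binomial_localWin_allFields L a b 1 ha hb ha3 hb3 hac hbc hab one_ne_zero
  rw [liftState_one_one] at h1
  set ν : Fin 4 → L := fun i => if i = j then s else 1 with hν
  have hν0 : ∀ i, ν i ≠ 0 := fun i => by
    simp only [hν]
    split_ifs
    · exact hs
    · exact one_ne_zero
  have hsa : s ^ a j ≠ 0 := pow_ne_zero _ hs
  have hc : (s ^ a j)⁻¹ ≠ 0 := inv_ne_zero hsa
  have h2 := (Torus.rWins_C_mul_scale_iff (q := 3) hc hν0 (monomial (expo a) (1 : L) + monomial (expo b) 1) 0 ∅).mpr h1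
  have hprod : ∀ d : Fin 4 → ℕ, (∏ i, ν i ^ (expo d) i) = s ^ d j := fun d => by
    rw [Fintype.prod_eq_single j (fun i hi => by simp [hν, hi])]
    simp [hν]
  have hEq : C (s ^ a j)⁻¹ * aeval (fun i => C (ν i) * X i) (monomial (expo a) (1 : L) + monomial (expo b) 1) =
      monomial (expo a) 1 + monomial (expo b) t := by
    rw [map_add, Torus.scale_monomial, Torus.scale_monomial, hprod, hprod, one_mul, one_mul, mul_add, C_mul_monomial,
      C_mul_monomial, inv_mul_cancel₀ hsa, hst, ← mul_assoc, inv_mul_cancel₀ hsa, one_mul]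
  rw [hEq] at h2
  exact h2

/-- **every unit coefficient over an algebraically closed field**: for `L` algebraically closed of characteristic 3, every
state `⟨x^a + t·x^b, 0, ∅⟩` with `t ≠ 0` and `(a, b)` in the binomial class is an A-win of OUR local in-scope game. [OURS] -/
theorem binomial_localWin_of_isAlgClosed [IsAlgClosed L] (a b : Fin 4 → ℕ) (ha : ∀ i, a i ≤ 3) (hb : ∀ i, b i ≤ 3)
    (ha3 : 3 ≤ ∑ i, a i) (hb3 : 3 ≤ ∑ i, b i) (hac : ¬ ∀ i, 3 ∣ a i) (hbc : ¬ ∀ i, 3 ∣ b i) (hab : a ≠ b) {t : L}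
    (ht : t ≠ 0) : RWins 3 localB (⟨monomial (expo a) 1 + monomial (expo b) t, 0, ∅⟩ : State L) := by
  obtain ⟨j, hj⟩ : ∃ j, a j ≠ b j := Function.ne_iff.mp hab
  rcases Nat.lt_or_gt_of_ne hj with hlt | hgt
  · obtain ⟨s, hs⟩ := IsAlgClosed.exists_pow_nat_eq t (Nat.sub_pos_of_lt hlt)
    have hs0 : s ≠ 0 := by
      rintro rfl
      rw [zero_pow (Nat.sub_ne_zero_of_lt hlt)] at hs
      exact ht hs.symm
    refine binomial_localWin_of_scaling L a b ha hb ha3 hb3 hac hbc hab hs0 j ?_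
    rw [← hs, ← pow_add, Nat.add_sub_cancel' hlt.le]
  · obtain ⟨s, hs⟩ := IsAlgClosed.exists_pow_nat_eq t⁻¹ (Nat.sub_pos_of_lt hgt)
    have hs0 : s ≠ 0 := by
      rintro rfl
      rw [zero_pow (Nat.sub_ne_zero_of_lt hgt)] at hs
      exact inv_ne_zero ht hs.symm
    refine binomial_localWin_of_scaling L a b ha hb ha3 hb3 hac hbc hab hs0 j ?_
    have h' : s ^ a j = s ^ b j * t⁻¹ := by rw [← hs, ← pow_add, Nat.add_sub_cancel' hgt.le]
    rw [h', mul_assoc, inv_mul_cancel₀ ht, mul_one]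

/-- **every unit coefficient reached by the FULL torus** (any field of characteristic 3): if `ν ∈ (Lˣ)⁴` satisfies
`∏ νᵢ^{bᵢ} = (∏ νᵢ^{aᵢ})·t`, then `⟨x^a + t·x^b, 0, ∅⟩` is an A-win of OUR local in-scope game — e.g. every `t` in the subgroup
of `Lˣ` generated by the `|bᵢ − aᵢ|`-th powers; `binomial_localWin_of_scaling` is the one-coordinate case. [OURS] -/
theorem binomial_localWin_of_torus (a b : Fin 4 → ℕ) (ha : ∀ i, a i ≤ 3) (hb : ∀ i, b i ≤ 3) (ha3 : 3 ≤ ∑ i, a i)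
    (hb3 : 3 ≤ ∑ i, b i) (hac : ¬ ∀ i, 3 ∣ a i) (hbc : ¬ ∀ i, 3 ∣ b i) (hab : a ≠ b) {ν : Fin 4 → L}
    (hν : ∀ i, ν i ≠ 0) {t : L} (hst : (∏ i, ν i ^ b i) = (∏ i, ν i ^ a i) * t) :
    RWins 3 localB (⟨monomial (expo a) 1 + monomial (expo b) t, 0, ∅⟩ : State L) := by
  have h1 := binomial_localWin_allFields L a b 1 ha hb ha3 hb3 hac hbc hab one_ne_zero
  rw [liftState_one_one] at h1
  have hpa : (∏ i, ν i ^ a i) ≠ 0 := Finset.prod_ne_zero_iff.mpr fun i _ => pow_ne_zero _ (hν i)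
  have hc : (∏ i, ν i ^ a i)⁻¹ ≠ 0 := inv_ne_zero hpa
  have h2 := (Torus.rWins_C_mul_scale_iff (q := 3) hc hν (monomial (expo a) (1 : L) + monomial (expo b) 1) 0 ∅).mpr h1
  have hprod : ∀ d : Fin 4 → ℕ, (∏ i, ν i ^ (expo d) i) = ∏ i, ν i ^ d i := fun d => rfl
  have hEq : C (∏ i, ν i ^ a i)⁻¹ * aeval (fun i => C (ν i) * X i) (monomial (expo a) (1 : L) + monomial (expo b) 1) =
      monomial (expo a) 1 + monomial (expo b) t := by
    rw [map_add, Torus.scale_monomial, Torus.scale_monomial, hprod, hprod, one_mul, one_mul, mul_add, C_mul_monomial,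
      C_mul_monomial, inv_mul_cancel₀ hpa, hst, ← mul_assoc, inv_mul_cancel₀ hpa, one_mul]
  rw [hEq] at h2
  exact h2

end BinomialClass

end LoopCLocal

end Summit.ResolutionOfSingularities.ResolutionOfSingularities.Theorems.PIDim4

end
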